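import Mathlib
import Literature.MathematicalPhysics.QuantumFieldTheory.Balaban1983to89.B5Bound128Uniform
import Summits.QuantumFields.BalabanUV.T4Continuum.Support.SliceFlatHeatOneDim

/-!
# T⁴ programme, node NE3 (η-rate of the minimisers) — THE FLAT RUNG, part 8: the exponentially WEIGHTED ℓ¹ bounds
# `Σ_m e^{β|m|}|q_t(m)| ≤ 48·e^{4β²T}` and `Σ_m e^{β|m|}|q_t(m+1) − q_t(m)| ≤ 1260·T^{−1/2}·e^{8β²T}` on `ℤ`

Fifteenth generation of the NE3 prover lineage P1 of the cell `pub-balaban`, file 2 (of the free-gradient chain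
`SliceFlatHeatOneDim → SliceFlatHeatWeighted → SliceFlatHeatTorus → SliceFlatFreeResolvent → SliceFlatGradient`, whose end is the
last flat stability reading of the lineage's one type `SliceCovariantLevels.ne3Shape_torusCovE_upto_of_printedStatements`
(p199789): item 1 of [B9] (3.42) ∕ entries 2–3 of [B5] (1.110), `∇G` and `G∇*`, AT `U = 1`).

Part 7 (`SliceFlatHeatOneDim`) proved the hybrid pointwise bounds `|q_t(m)| ≤ T^{−1/2}(e^{−m²/(8T)} + e^{−|m|/8})` and
`|q_t(m+1) − q_t(m)| ≤ 15·T^{−1}(e^{−m²/(16T)} + e^{−|m|/16})` (`T = 1 ∨ t`) for the tree's heat kernel `q_t = srwHeatKernel t` of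
the continuous-time simple random walk on `ℤ`.  THIS FILE sums them against an exponential weight `e^{β|m|}` of small slope
(in the application `β = α/n`, `n` the block side):
 * §3 the two-sided geometric series `Σ_{m∈ℤ} e^{−γ|m|} = (1 + e^{−γ})/(1 − e^{−γ}) ≤ 2(1 + γ⁻¹)` and, completing the square,
   the weighted Gaussian series `Σ_m e^{β|m|}e^{−am²} ≤ 2(1 + a^{−1/2})e^{β²/(2a) + 1/2}`;
 * §4 **`weighted_tsum_srw_le`**: `Σ_m e^{β|m|}|q_t(m)| ≤ 48·e^{4β²T}` (`β ≤ 1/16`) and **`weighted_tsum_fwdDiff_srw_le`**: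
   `Σ_m e^{β|m|}|q_t(m+1) − q_t(m)| ≤ 1260·T^{−1/2}·e^{8β²T}` (`β ≤ 1/32`), both with summability — the difference keeps ONE
   factor `T^{−1/2}` beyond the kernel, uniformly in the weight; the price of the weight is the factor `e^{cβ²T}`, which for
   `β = α/n` and heat time `T ≍ t` is `e^{cα²t/n²}`, absorbed by the Laplace weight `e^{−t/n²}` of the massive resolvent
   (part 10).
All constants are absolute.  Nothing here is specific to a gauge theory.

Honest framing: finite-T⁴ ultraviolet bookkeeping about MINIMISERS (rung (B)+1 of the cell's ladder); no conditional of the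
cell (`BetaPertH`, (B), (B^μ)) is used or hidden; nothing bears on infinite volume, a mass gap, or the Clay problem; NE3 is NOT
proved by this file.  ABSOLUTE RULE of the cell kept: the only inputs are Mathlib and kernel-proved tree modules (part 7 and,
through it, `Literature.Probability.LatticeModels.SRWHeatKernel1D` ∕ `…Differences`, after Lawler–Limic 2010 §2.3; the elementary
`(1 − e^{−x})⁻¹ ≤ 1 + x⁻¹` is reused from pv15's `B5Bound128Uniform.inv_one_sub_exp_neg_le`); every
declaration is [folklore] classical analysis, no `def … : Prop`, no `sorry`, no axioms beyond Mathlib's.  PLACEMENT (human rule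
2026-08-19): cell work under `Summits/QuantumFields/BalabanUV/`; moves nothing.  Records: `t4/T4-EST-U1b-OSC.md` v1.32,
`t4/T4-EST-NE3-P1.md` v2.31 of the cell `pub-balaban`.
-/

noncomputable section

open Real Finset Filter

namespace Summit.QuantumFields.BalabanUV.T4Continuum.SliceFlatHeatWeighted

open Literature.Probability.LatticeModels
open Literature.MathematicalPhysics.QuantumFieldTheory.Balaban1983to89.B5Bound128Uniform (inv_one_sub_exp_neg_le)
open Summit.QuantumFields.BalabanUV.T4Continuum.SliceFlatHeatOneDim

/-! ## §3  Weighted geometric and Gaussian series over `ℤ` -/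
section Series

/-- **The two-sided geometric series**: `Σ_{m ∈ ℤ} e^{−γ|m|} = (1 + e^{−γ})/(1 − e^{−γ})` for `γ > 0`. [folklore] -/
theorem hasSum_exp_neg_mul_abs {γ : ℝ} (hγ : 0 < γ) :
    HasSum (fun m : ℤ => Real.exp (-(γ * |(m : ℝ)|))) ((1 + Real.exp (-γ)) / (1 - Real.exp (-γ))) := by
  set r : ℝ := Real.exp (-γ) with hr
  have hr0 : 0 ≤ r := (Real.exp_pos _).le
  have hr1 : r < 1 := Real.exp_lt_one_iff.2 (by linarith)
  have hr1' : 0 < 1 - r := by linarith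
  have hgeo := hasSum_geometric_of_lt_one hr0 hr1
  have hpow : ∀ n : ℕ, Real.exp (-(γ * (n : ℝ))) = r ^ n := fun n => by
    rw [hr, ← Real.exp_nat_mul]; congr 1; ring
  have hf1 : (fun n : ℕ => Real.exp (-(γ * |((n : ℤ) : ℝ)|))) = fun n => r ^ n := by
    funext n
    rw [Int.cast_natCast, Nat.abs_cast, hpow]
  have h1 : HasSum (fun n : ℕ => Real.exp (-(γ * |((n : ℤ) : ℝ)|))) (1 - r)⁻¹ := by rw [hf1]; exact hgeo
  have hf2 : (fun n : ℕ => (fun m : ℤ => Real.exp (-(γ * |(m : ℝ)|))) (-(n + 1))) = fun n => r * r ^ n := by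
    funext n
    have : |(((-((n : ℤ) + 1) : ℤ)) : ℝ)| = (n : ℝ) + 1 := by
      push_cast; rw [abs_neg]; exact abs_of_nonneg (by positivity)
    simp only []
    rw [this, show (n : ℝ) + 1 = ((n + 1 : ℕ) : ℝ) by push_cast; ring, hpow, pow_succ, mul_comm]
  have h2 : HasSum (fun n : ℕ => (fun m : ℤ => Real.exp (-(γ * |(m : ℝ)|))) (-(n + 1))) (r * (1 - r)⁻¹) := by
    rw [hf2]; exact hgeo.mul_left r
  have h := HasSum.of_nat_of_neg_add_one (f := fun m : ℤ => Real.exp (-(γ * |(m : ℝ)|))) h1 h2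
  have e : (1 - r)⁻¹ + r * (1 - r)⁻¹ = (1 + r) / (1 - r) := by field_simp
  rw [e] at h
  exact h

/-- `Σ_{m ∈ ℤ} e^{−γ|m|} ≤ 2(1 + γ⁻¹)` for `γ > 0`, with summability. [folklore] -/
theorem tsum_exp_neg_mul_abs_le {γ : ℝ} (hγ : 0 < γ) :
    Summable (fun m : ℤ => Real.exp (-(γ * |(m : ℝ)|))) ∧
      ∑' m : ℤ, Real.exp (-(γ * |(m : ℝ)|)) ≤ 2 * (1 + γ⁻¹) := by
  have h := hasSum_exp_neg_mul_abs hγ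
  refine ⟨h.summable, ?_⟩
  rw [h.tsum_eq]
  have hr1 : Real.exp (-γ) ≤ 1 := (Real.exp_lt_one_iff.2 (by linarith)).le
  have hr1' : 0 < 1 - Real.exp (-γ) := by linarith [Real.exp_lt_one_iff.2 (by linarith : -γ < 0)]
  have hinv := inv_one_sub_exp_neg_le hγ
  calc (1 + Real.exp (-γ)) / (1 - Real.exp (-γ)) ≤ 2 / (1 - Real.exp (-γ)) :=
        div_le_div_of_nonneg_right (by linarith) hr1'.le
    _ = 2 * (1 - Real.exp (-γ))⁻¹ := div_eq_mul_inv _ _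
    _ ≤ 2 * (1 + γ⁻¹) := by gcongr

/-- **Completing the square against a Gaussian**: `e^{β|m|}e^{−am²} ≤ e^{β²/(2a) + 1/2}·e^{−√a|m|}` (`a > 0`). [folklore] -/
theorem exp_weight_gauss_le {a : ℝ} (ha : 0 < a) (β m : ℝ) :
    Real.exp (β * |m|) * Real.exp (-(a * m ^ 2)) ≤ Real.exp (β ^ 2 / (2 * a) + 1 / 2) * Real.exp (-(Real.sqrt a * |m|)) := by
  rw [← Real.exp_add, ← Real.exp_add]
  refine Real.exp_le_exp.2 ?_
  set u := |m| with hu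
  have hu0 : 0 ≤ u := abs_nonneg m
  have hm2 : m ^ 2 = u ^ 2 := (sq_abs m).symm
  rw [hm2]
  have hs : Real.sqrt a ^ 2 = a := Real.sq_sqrt ha.le
  have p1 : β * u ≤ a / 2 * u ^ 2 + β ^ 2 / (2 * a) := by
    have h := sq_nonneg (a * u - β)
    have e : (a * u - β) ^ 2 / (2 * a) = a / 2 * u ^ 2 - β * u + β ^ 2 / (2 * a) := by field_simp; ring
    nlinarith [div_nonneg h (by positivity : (0 : ℝ) ≤ 2 * a)]
  have p2 : Real.sqrt a * u ≤ a / 2 * u ^ 2 + 1 / 2 := by nlinarith [sq_nonneg (Real.sqrt a * u - 1)]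
  linarith

/-- **The weighted Gaussian series**: `Σ_{m ∈ ℤ} e^{β|m|}e^{−am²} ≤ 2(1 + a^{−1/2})·e^{β²/(2a) + 1/2}` (`a > 0`), with
summability. [folklore] -/
theorem tsum_exp_weight_gauss_le {a : ℝ} (ha : 0 < a) (β : ℝ) :
    Summable (fun m : ℤ => Real.exp (β * |(m : ℝ)|) * Real.exp (-(a * (m : ℝ) ^ 2))) ∧
      ∑' m : ℤ, Real.exp (β * |(m : ℝ)|) * Real.exp (-(a * (m : ℝ) ^ 2))
        ≤ 2 * (1 + (Real.sqrt a)⁻¹) * Real.exp (β ^ 2 / (2 * a) + 1 / 2) := by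
  have hsa : 0 < Real.sqrt a := Real.sqrt_pos.2 ha
  obtain ⟨hsum, hle⟩ := tsum_exp_neg_mul_abs_le hsa
  set C := Real.exp (β ^ 2 / (2 * a) + 1 / 2) with hC
  have hC0 : 0 ≤ C := (Real.exp_pos _).le
  have hmaj : Summable fun m : ℤ => C * Real.exp (-(Real.sqrt a * |(m : ℝ)|)) := hsum.mul_left C
  have hpt : ∀ m : ℤ, Real.exp (β * |(m : ℝ)|) * Real.exp (-(a * (m : ℝ) ^ 2)) ≤ C * Real.exp (-(Real.sqrt a * |(m : ℝ)|)) :=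
    fun m => exp_weight_gauss_le ha β m
  have hnn : ∀ m : ℤ, 0 ≤ Real.exp (β * |(m : ℝ)|) * Real.exp (-(a * (m : ℝ) ^ 2)) := fun m => by positivity
  have hS : Summable fun m : ℤ => Real.exp (β * |(m : ℝ)|) * Real.exp (-(a * (m : ℝ) ^ 2)) :=
    Summable.of_nonneg_of_le hnn hpt hmaj
  refine ⟨hS, ?_⟩
  calc ∑' m : ℤ, Real.exp (β * |(m : ℝ)|) * Real.exp (-(a * (m : ℝ) ^ 2))
      ≤ ∑' m : ℤ, C * Real.exp (-(Real.sqrt a * |(m : ℝ)|)) := Summable.tsum_le_tsum hpt hS hmaj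
    _ = C * ∑' m : ℤ, Real.exp (-(Real.sqrt a * |(m : ℝ)|)) := tsum_mul_left
    _ ≤ C * (2 * (1 + (Real.sqrt a)⁻¹)) := mul_le_mul_of_nonneg_left hle hC0
    _ = 2 * (1 + (Real.sqrt a)⁻¹) * C := by ring

/-- Comparison bookkeeping: a nonnegative `g ≤ c₁h₁ + c₂h₂` with summable `h₁, h₂` of sums `≤ B₁, B₂` is summable with sum
`≤ c₁B₁ + c₂B₂`. [folklore] -/
theorem tsum_le_of_le_add {g h₁ h₂ : ℤ → ℝ} {c₁ c₂ B₁ B₂ : ℝ} (hg : ∀ m, 0 ≤ g m)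
    (hle : ∀ m, g m ≤ c₁ * h₁ m + c₂ * h₂ m) (h1 : Summable h₁) (h2 : Summable h₂)
    (hB1 : ∑' m, h₁ m ≤ B₁) (hB2 : ∑' m, h₂ m ≤ B₂) (hc1 : 0 ≤ c₁) (hc2 : 0 ≤ c₂) :
    Summable g ∧ ∑' m, g m ≤ c₁ * B₁ + c₂ * B₂ := by
  have hF : Summable fun m => c₁ * h₁ m + c₂ * h₂ m := (h1.mul_left c₁).add (h2.mul_left c₂)
  have hS : Summable g := Summable.of_nonneg_of_le hg hle hF
  refine ⟨hS, ?_⟩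
  calc ∑' m, g m ≤ ∑' m, (c₁ * h₁ m + c₂ * h₂ m) := Summable.tsum_le_tsum hle hS hF
    _ = c₁ * ∑' m, h₁ m + c₂ * ∑' m, h₂ m := by
        rw [Summable.tsum_add (h1.mul_left c₁) (h2.mul_left c₂), tsum_mul_left, tsum_mul_left]
    _ ≤ c₁ * B₁ + c₂ * B₂ := add_le_add (mul_le_mul_of_nonneg_left hB1 hc1) (mul_le_mul_of_nonneg_left hB2 hc2)

end Series

/-! ## §4  The exponentially weighted ℓ¹ bounds -/
section Weighted

/-- `e^{1/2} ≤ 7/4` (tree) and `√8 ≤ 3`. [folklore] -/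
theorem sqrt_eight_le_three : Real.sqrt 8 ≤ 3 := by
  rw [Real.sqrt_le_left (by norm_num)]; norm_num

/-- **WEIGHTED ℓ¹ BOUND FOR THE HEAT KERNEL**: for `t > 0`, `0 ≤ β ≤ 1/16`, `T = 1 ∨ t`,
`Σ_{m ∈ ℤ} e^{β|m|}|q_t(m)| ≤ 48·e^{4β²T}`, with summability (`β < 0` allowed). [folklore] -/
theorem weighted_tsum_srw_le {t : ℝ} (ht : 0 < t) {β : ℝ} (hβ : β ≤ 1 / 16) :
    Summable (fun m : ℤ => Real.exp (β * |(m : ℝ)|) * |srwHeatKernel t m|) ∧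
      ∑' m : ℤ, Real.exp (β * |(m : ℝ)|) * |srwHeatKernel t m| ≤ 48 * Real.exp (4 * β ^ 2 * max 1 t) := by
  obtain ⟨hT1, hT0, hThalf, hTT, hsq⟩ := max_one_facts t
  set T := max 1 t with hTdef
  have ha : 0 < 1 / (8 * T) := by positivity
  -- Gaussian majorant
  obtain ⟨hS1, hB1⟩ := tsum_exp_weight_gauss_le ha β
  -- Poisson majorant: `e^{β|m|}e^{−|m|/8} ≤ e^{−|m|/16}`
  obtain ⟨hS2, hB2⟩ := tsum_exp_neg_mul_abs_le (show (0 : ℝ) < 1 / 16 by norm_num)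
  have hpt : ∀ m : ℤ, Real.exp (β * |(m : ℝ)|) * |srwHeatKernel t m|
      ≤ T ^ (-(1 / 2 : ℝ)) * (Real.exp (β * |(m : ℝ)|) * Real.exp (-(1 / (8 * T) * (m : ℝ) ^ 2)))
        + 1 * Real.exp (-(1 / 16 * |(m : ℝ)|)) := by
    intro m
    have h := abs_srw_le_hybrid ht m
    have hw : 0 ≤ Real.exp (β * |(m : ℝ)|) := (Real.exp_pos _).le
    have e1 : Real.exp (-((m : ℝ) ^ 2 / (8 * T))) = Real.exp (-(1 / (8 * T) * (m : ℝ) ^ 2)) := by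
      congr 1; field_simp
    have e2 : Real.exp (β * |(m : ℝ)|) * Real.exp (-(|(m : ℝ)| / 8)) ≤ Real.exp (-(1 / 16 * |(m : ℝ)|)) := by
      rw [← Real.exp_add]; refine Real.exp_le_exp.2 ?_; nlinarith [abs_nonneg (m : ℝ)]
    calc Real.exp (β * |(m : ℝ)|) * |srwHeatKernel t m|
        ≤ Real.exp (β * |(m : ℝ)|) * (T ^ (-(1 / 2 : ℝ)) *
            (Real.exp (-((m : ℝ) ^ 2 / (8 * T))) + Real.exp (-(|(m : ℝ)| / 8)))) := mul_le_mul_of_nonneg_left h hw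
      _ = T ^ (-(1 / 2 : ℝ)) * (Real.exp (β * |(m : ℝ)|) * Real.exp (-(1 / (8 * T) * (m : ℝ) ^ 2)))
            + T ^ (-(1 / 2 : ℝ)) * (Real.exp (β * |(m : ℝ)|) * Real.exp (-(|(m : ℝ)| / 8))) := by rw [e1]; ring
      _ ≤ T ^ (-(1 / 2 : ℝ)) * (Real.exp (β * |(m : ℝ)|) * Real.exp (-(1 / (8 * T) * (m : ℝ) ^ 2)))
            + 1 * Real.exp (-(1 / 16 * |(m : ℝ)|)) := by
          gcongr
  have hnn : ∀ m : ℤ, 0 ≤ Real.exp (β * |(m : ℝ)|) * |srwHeatKernel t m| := fun m => by positivity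
  obtain ⟨hS, hB⟩ := tsum_le_of_le_add hnn hpt hS1 hS2 hB1 hB2 (Real.rpow_nonneg hT0.le _) zero_le_one
  refine ⟨hS, hB.trans ?_⟩
  -- numerics: `T^{−1/2}·2(1 + √(8T))·e^{4β²T + 1/2} + 2·17 ≤ 48 e^{4β²T}`
  have hsqrt8T : Real.sqrt (1 / (8 * T)) = (Real.sqrt 8 * Real.sqrt T)⁻¹ := by
    rw [← Real.sqrt_mul (by norm_num), Real.sqrt_div' _ (by positivity : (0:ℝ) ≤ 8 * T), Real.sqrt_one, one_div]
  have hexp : Real.exp (β ^ 2 / (2 * (1 / (8 * T))) + 1 / 2) = Real.exp (4 * β ^ 2 * T) * Real.exp (1 / 2) := by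
    rw [← Real.exp_add]; congr 1; field_simp; ring
  have hE0 : 0 ≤ Real.exp (4 * β ^ 2 * T) := (Real.exp_pos _).le
  have hE1 : 1 ≤ Real.exp (4 * β ^ 2 * T) := Real.one_le_exp (by positivity)
  have hgauss : T ^ (-(1 / 2 : ℝ)) * (2 * (1 + (Real.sqrt (1 / (8 * T)))⁻¹) * Real.exp (β ^ 2 / (2 * (1 / (8 * T))) + 1 / 2))
      ≤ 14 * Real.exp (4 * β ^ 2 * T) := by
    rw [hsqrt8T, inv_inv, hexp]
    have h1 : T ^ (-(1 / 2 : ℝ)) * (Real.sqrt 8 * Real.sqrt T) = Real.sqrt 8 := by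
      calc T ^ (-(1 / 2 : ℝ)) * (Real.sqrt 8 * Real.sqrt T) = Real.sqrt 8 * (Real.sqrt T * T ^ (-(1 / 2 : ℝ))) := by ring
        _ = Real.sqrt 8 := by rw [hsq, mul_one]
    calc T ^ (-(1 / 2 : ℝ)) * (2 * (1 + Real.sqrt 8 * Real.sqrt T) * (Real.exp (4 * β ^ 2 * T) * Real.exp (1 / 2)))
        = 2 * (T ^ (-(1 / 2 : ℝ)) + T ^ (-(1 / 2 : ℝ)) * (Real.sqrt 8 * Real.sqrt T)) * Real.exp (1 / 2)
            * Real.exp (4 * β ^ 2 * T) := by ring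
      _ ≤ 2 * (1 + 3) * (7 / 4) * Real.exp (4 * β ^ 2 * T) := by
          rw [h1]
          gcongr
          · exact sqrt_eight_le_three
          · exact exp_half_le
      _ = 14 * Real.exp (4 * β ^ 2 * T) := by norm_num
  have hpois : (1 : ℝ) * (2 * (1 + (1 / 16 : ℝ)⁻¹)) ≤ 34 * Real.exp (4 * β ^ 2 * T) := by
    have e : (1 : ℝ) * (2 * (1 + (1 / 16 : ℝ)⁻¹)) = 34 := by norm_num
    rw [e]; nlinarith [hE1]
  linarith [hB, hgauss, hpois]

/-- **WEIGHTED ℓ¹ BOUND FOR THE FORWARD DIFFERENCE**: for `t > 0`, `0 ≤ β ≤ 1/32`, `T = 1 ∨ t`,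
`Σ_{m ∈ ℤ} e^{β|m|}|q_t(m+1) − q_t(m)| ≤ 1260·T^{−1/2}·e^{8β²T}`, with summability — one factor `T^{−1/2}` beyond the
kernel itself, uniformly in the weight. [folklore] -/
theorem weighted_tsum_fwdDiff_srw_le {t : ℝ} (ht : 0 < t) {β : ℝ} (hβ : β ≤ 1 / 32) :
    Summable (fun m : ℤ => Real.exp (β * |(m : ℝ)|) * |srwHeatKernel t (m + 1) - srwHeatKernel t m|) ∧
      ∑' m : ℤ, Real.exp (β * |(m : ℝ)|) * |srwHeatKernel t (m + 1) - srwHeatKernel t m|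
        ≤ 1260 * (max 1 t) ^ (-(1 / 2 : ℝ)) * Real.exp (8 * β ^ 2 * max 1 t) := by
  obtain ⟨hT1, hT0, hThalf, hTT, hsq⟩ := max_one_facts t
  set T := max 1 t with hTdef
  have ha : 0 < 1 / (16 * T) := by positivity
  obtain ⟨hS1, hB1⟩ := tsum_exp_weight_gauss_le ha β
  obtain ⟨hS2, hB2⟩ := tsum_exp_neg_mul_abs_le (show (0 : ℝ) < 1 / 32 by norm_num)
  have hpt : ∀ m : ℤ, Real.exp (β * |(m : ℝ)|) * |srwHeatKernel t (m + 1) - srwHeatKernel t m|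
      ≤ 15 * T⁻¹ * (Real.exp (β * |(m : ℝ)|) * Real.exp (-(1 / (16 * T) * (m : ℝ) ^ 2)))
        + 15 * T⁻¹ * Real.exp (-(1 / 32 * |(m : ℝ)|)) := by
    intro m
    have h := abs_fwdDiff_srw_le_hybrid ht m
    have hw : 0 ≤ Real.exp (β * |(m : ℝ)|) := (Real.exp_pos _).le
    have e1 : Real.exp (-((m : ℝ) ^ 2 / (16 * T))) = Real.exp (-(1 / (16 * T) * (m : ℝ) ^ 2)) := by
      congr 1; field_simp
    have e2 : Real.exp (β * |(m : ℝ)|) * Real.exp (-(|(m : ℝ)| / 16)) ≤ Real.exp (-(1 / 32 * |(m : ℝ)|)) := by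
      rw [← Real.exp_add]; refine Real.exp_le_exp.2 ?_; nlinarith [abs_nonneg (m : ℝ)]
    have h15 : 0 ≤ 15 * T⁻¹ := by positivity
    calc Real.exp (β * |(m : ℝ)|) * |srwHeatKernel t (m + 1) - srwHeatKernel t m|
        ≤ Real.exp (β * |(m : ℝ)|) * (15 * T⁻¹ *
            (Real.exp (-((m : ℝ) ^ 2 / (16 * T))) + Real.exp (-(|(m : ℝ)| / 16)))) := mul_le_mul_of_nonneg_left h hw
      _ = 15 * T⁻¹ * (Real.exp (β * |(m : ℝ)|) * Real.exp (-(1 / (16 * T) * (m : ℝ) ^ 2)))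
            + 15 * T⁻¹ * (Real.exp (β * |(m : ℝ)|) * Real.exp (-(|(m : ℝ)| / 16))) := by rw [e1]; ring
      _ ≤ 15 * T⁻¹ * (Real.exp (β * |(m : ℝ)|) * Real.exp (-(1 / (16 * T) * (m : ℝ) ^ 2)))
            + 15 * T⁻¹ * Real.exp (-(1 / 32 * |(m : ℝ)|)) := by gcongr
  have hnn : ∀ m : ℤ, 0 ≤ Real.exp (β * |(m : ℝ)|) * |srwHeatKernel t (m + 1) - srwHeatKernel t m| :=
    fun m => by positivity
  have h15 : 0 ≤ 15 * T⁻¹ := by positivity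
  obtain ⟨hS, hB⟩ := tsum_le_of_le_add hnn hpt hS1 hS2 hB1 hB2 h15 h15
  refine ⟨hS, hB.trans ?_⟩
  -- numerics
  have hsqrt16T : Real.sqrt (1 / (16 * T)) = (4 * Real.sqrt T)⁻¹ := by
    rw [Real.sqrt_div' _ (by positivity : (0:ℝ) ≤ 16 * T), Real.sqrt_one, one_div, Real.sqrt_mul (by norm_num),
      show Real.sqrt 16 = 4 by rw [show (16:ℝ) = 4 ^ 2 by norm_num, Real.sqrt_sq (by norm_num)]]
  have hexp : Real.exp (β ^ 2 / (2 * (1 / (16 * T))) + 1 / 2) = Real.exp (8 * β ^ 2 * T) * Real.exp (1 / 2) := by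
    rw [← Real.exp_add]; congr 1; field_simp; ring
  have hE0 : 0 ≤ Real.exp (8 * β ^ 2 * T) := (Real.exp_pos _).le
  have hE1 : 1 ≤ Real.exp (8 * β ^ 2 * T) := Real.one_le_exp (by positivity)
  have hTinv : T⁻¹ = T ^ (-(1 / 2 : ℝ)) * T ^ (-(1 / 2 : ℝ)) := hTT.symm
  have hTn : 0 ≤ T ^ (-(1 / 2 : ℝ)) := Real.rpow_nonneg hT0.le _
  have hsqT1 : 1 ≤ Real.sqrt T := by rw [show (1:ℝ) = Real.sqrt 1 by simp]; exact Real.sqrt_le_sqrt hT1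
  have hgauss : 15 * T⁻¹ * (2 * (1 + (Real.sqrt (1 / (16 * T)))⁻¹) * Real.exp (β ^ 2 / (2 * (1 / (16 * T))) + 1 / 2))
      ≤ 263 * T ^ (-(1 / 2 : ℝ)) * Real.exp (8 * β ^ 2 * T) := by
    rw [hsqrt16T, inv_inv, hexp, hTinv]
    have h1 : T ^ (-(1 / 2 : ℝ)) * (1 + 4 * Real.sqrt T) ≤ 5 := by
      calc T ^ (-(1 / 2 : ℝ)) * (1 + 4 * Real.sqrt T) ≤ T ^ (-(1 / 2 : ℝ)) * (Real.sqrt T + 4 * Real.sqrt T) := by gcongr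
        _ = 5 * (Real.sqrt T * T ^ (-(1 / 2 : ℝ))) := by ring
        _ = 5 := by rw [hsq, mul_one]
    calc 15 * (T ^ (-(1 / 2 : ℝ)) * T ^ (-(1 / 2 : ℝ))) * (2 * (1 + 4 * Real.sqrt T) * (Real.exp (8 * β ^ 2 * T) * Real.exp (1 / 2)))
        = 30 * (T ^ (-(1 / 2 : ℝ)) * (1 + 4 * Real.sqrt T)) * Real.exp (1 / 2) * (T ^ (-(1 / 2 : ℝ)) * Real.exp (8 * β ^ 2 * T)) := by
          ring
      _ ≤ 30 * 5 * (7 / 4) * (T ^ (-(1 / 2 : ℝ)) * Real.exp (8 * β ^ 2 * T)) := by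
          gcongr
          exact exp_half_le
      _ ≤ 263 * T ^ (-(1 / 2 : ℝ)) * Real.exp (8 * β ^ 2 * T) := by nlinarith [mul_nonneg hTn hE0]
  have hpois : 15 * T⁻¹ * (2 * (1 + (1 / 32 : ℝ)⁻¹)) ≤ 990 * T ^ (-(1 / 2 : ℝ)) * Real.exp (8 * β ^ 2 * T) := by
    rw [hTinv]
    have h1 : T ^ (-(1 / 2 : ℝ)) * T ^ (-(1 / 2 : ℝ)) ≤ T ^ (-(1 / 2 : ℝ)) * 1 := mul_le_mul_of_nonneg_left hThalf hTn
    norm_num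
    nlinarith [mul_nonneg hTn hE0, mul_le_mul_of_nonneg_left hE1 hTn]
  nlinarith [mul_nonneg hTn hE0]

end Weighted

end Summit.QuantumFields.BalabanUV.T4Continuum.SliceFlatHeatWeighted
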